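import Mathlib.InformationTheory.KullbackLeibler.Basic
import Mathlib.Analysis.SpecialFunctions.Log.Basic
import HarnessLib

/-!
# The entropy inequality for events (Kipnis–Landim 1999, Appendix 1, Prop. 8.2)

Topic `Literature/Probability/Entropy`. One NAMED FACT filed by a grounder for the assembly items of
the routes `AtomisticToContinuum/HydrodynamicLimit/{RelEntropyErgodic, ChaoticMixing, …}`
(item `stmt-AtomisticToContinuum-0769`: `RelEntropyVanishing → HydrodynamicLimit`), which pass
from vanishing specific relative entropy `H(μ_N | λ_N)/(N+1) → 0` and exponential concentration
`λ_N(A_N) ≤ C e^{-(N+1)/C}` of the reference law to `μ_N(A_N) → 0`.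

## Content

* `KipnisLandim1999_A1_8_2` — for probability measures `μ`, `π` on a measurable space and an event
  `A` with `π A ≠ 0` and `H(μ | π) < ∞`:  `μ[A] ≤ (log 2 + H(μ | π)) / log (1 + 1/π[A])`.
  `H(μ | π)` is Mathlib's `InformationTheory.klDiv μ π` (`= ∫ log (dμ/dπ) dμ` for probability
  measures with `μ ≪ π` and integrable log-likelihood ratio, `= ∞` otherwise; the hypothesis
  `klDiv μ π ≠ ∞` makes the real-valued right-hand side meaningful).

## Source

* C. Kipnis, C. Landim, *Scaling Limits of Interacting Particle Systems*, Grundlehren 320,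
  Springer (1999), Appendix 1, §8, Prop. 8.2 (p. 338): "Let `A` be a subset of `E`.
  `μ[A] ≤ (log 2 + H(μ)) / log(1 + 1/π[A])`", proved from the entropy inequality
  `⟨μ, f⟩ ≤ α⁻¹ {log ⟨π, e^{αf}⟩ + H(μ | π)}` with `f = 𝟙_A` and `e^α = 1 + 1/π[A]`.

## Design choices / faithfulness

* Appendix 1 of the book works on a countable state space `E`; the statement and its two-line
  proof use only the variational formula `H(μ | π) = sup_f {⟨μ, f⟩ − log ⟨π, e^f⟩}` and are
  insensitive to this, and the inequality is used verbatim on continuum phase spaces in the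
  relative entropy method (Yau 1991; Olla–Varadhan–Yau 1993, §1). It is vendored here for a
  general measurable space — reviewers: this is the only deviation from the printed wording.
* Mathlib has `klDiv` with `mul_log_le_toReal_klDiv` (the one-set case) but neither the
  Donsker–Varadhan variational formula nor the data-processing inequality from which Prop. 8.2
  would follow in a few lines; hence a named fact rather than a theorem.
-/

noncomputable section

open MeasureTheory

namespace Literature.Probability.Entropy

/-- NAMED FACT — **the entropy inequality for events** (Kipnis–Landim 1999, Appendix 1,
Prop. 8.2: "Let `A` be a subset of `E`. Then `μ[A] ≤ (log 2 + H(μ | π)) / log(1 + 1/π[A])`."),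
for probability measures on a measurable space, with `H(μ | π) = InformationTheory.klDiv μ π`
assumed finite and `π[A] ≠ 0`. Users take `(h : KipnisLandim1999_A1_8_2)`; grounds the assembly
`Summit.AtomisticToContinuum.HydrodynamicLimit.Theses.RelEntropyErgodic.Assembly`.
[cite: KipnisLandim1999, Appendix 1 Prop. 8.2] -/
def KipnisLandim1999_A1_8_2 : Prop :=
  ∀ (E : Type) [MeasurableSpace E] (μ π : Measure E) [IsProbabilityMeasure μ]
    [IsProbabilityMeasure π] (A : Set E), MeasurableSet A → π A ≠ 0 →
    InformationTheory.klDiv μ π ≠ ⊤ →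
      (μ A).toReal ≤
        (Real.log 2 + (InformationTheory.klDiv μ π).toReal) / Real.log (1 + (π A).toReal⁻¹)

end Literature.Probability.Entropy

end

/-!
## Discharge

`KipnisLandim1999_A1_8_2_holds` proves the named fact from Mathlib, following the printed proof
(Kipnis–Landim 1999, Appendix 1 §8, Prop. 8.2, p. 338): the entropy inequality
`⟨μ, f⟩ − log ⟨π, e^f⟩ ≤ H(μ | π)` is obtained as `0 ≤ H(μ | π_f)` for the tilted measure
`π_f = e^f π / ⟨π, e^f⟩` (Mathlib's `Measure.tilted`, `integral_llr_tilted_right`,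
`toReal_klDiv_of_measure_eq`), applied with `f = α 𝟙_A`, `α = log (1 + 1/π[A])`, for which
`⟨π, e^f⟩ = 1 + (e^α − 1) π[A] = 2`. (In the proof script the reference measure is written `ν`,
since `π` is Mathlib notation for `Real.pi` inside terms.)
-/

namespace Literature.Probability.Entropy

open MeasureTheory InformationTheory in
/-- **Kipnis–Landim 1999, Appendix 1, Prop. 8.2** holds: for probability measures `μ`, `π` with
`H(μ | π) = klDiv μ π < ∞` and an event `A` with `π A ≠ 0`,
`μ[A] ≤ (log 2 + H(μ | π)) / log (1 + 1/π[A])`.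
[cite: KipnisLandim1999, Appendix 1 Prop. 8.2 (p. 338)] -/
theorem KipnisLandim1999_A1_8_2_holds : KipnisLandim1999_A1_8_2 := by
  intro E _ μ ν _ _ A hA hνA hH
  obtain ⟨hμν, h_int⟩ := klDiv_ne_top_iff.mp hH
  -- `q = ν A > 0`, `a = log (1 + 1/q) > 0`, `f = a • 𝟙_A`.
  set q : ℝ := (ν A).toReal with hq_def
  have hq : 0 < q := ENNReal.toReal_pos hνA (measure_ne_top ν A)
  set a : ℝ := Real.log (1 + q⁻¹) with ha_def
  have ha : 0 < a := Real.log_pos (by have := inv_pos.mpr hq; linarith)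
  have hexp_a : Real.exp a = 1 + q⁻¹ := by
    rw [ha_def, Real.exp_log (by positivity)]
  set f : E → ℝ := A.indicator (fun _ => a) with hf_def
  have hfμ : Integrable f μ := (integrable_const a).indicator hA
  -- `e^f = 1 + (e^a - 1) 𝟙_A`, hence integrable with `∫ e^f dν = 2`.
  have hexp_f :
      (fun x => Real.exp (f x)) = fun x => 1 + A.indicator (fun _ => Real.exp a - 1) x := by
    funext x
    by_cases hx : x ∈ A <;> simp [hf_def, hx]
  have hfν : Integrable (fun x => Real.exp (f x)) ν := by
    rw [hexp_f]
    exact (integrable_const _).add ((integrable_const _).indicator hA)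
  have hint_exp : ∫ x, Real.exp (f x) ∂ν = 2 := by
    rw [hexp_f, integral_add (integrable_const _) ((integrable_const _).indicator hA),
      integral_const, integral_indicator_const _ hA, hexp_a]
    rw [probReal_univ, one_smul, measureReal_def, ← hq_def, smul_eq_mul, add_sub_cancel_left,
      mul_inv_cancel₀ hq.ne']
    norm_num
  have hint_f : ∫ x, f x ∂μ = (μ A).toReal * a := by
    rw [hf_def, integral_indicator_const _ hA, smul_eq_mul, measureReal_def]
  -- The tilted measure `ν.tilted f` is a probability measure with `μ ≪ ν.tilted f`.
  haveI : IsProbabilityMeasure (ν.tilted f) := isProbabilityMeasure_tilted hfν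
  have hμ_tilt : μ ≪ ν.tilted f := hμν.trans (absolutelyContinuous_tilted hfν)
  -- `0 ≤ H(μ | ν.tilted f) = H(μ | ν) - ∫ f dμ + log ∫ e^f dν`.
  have h_nonneg : 0 ≤ ∫ x, llr μ (ν.tilted f) x ∂μ := by
    rw [← toReal_klDiv_of_measure_eq hμ_tilt (by simp)]
    exact ENNReal.toReal_nonneg
  rw [integral_llr_tilted_right hμν hfμ hfν h_int, hint_f, hint_exp,
    ← toReal_klDiv_of_measure_eq hμν (by simp)] at h_nonneg
  rw [le_div_iff₀ ha]
  linarith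

end Literature.Probability.Entropy
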